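import Literature.MathematicalPhysics.QuantumFieldTheory.Balaban1983to89.Beta.LargeL

/-!
# `Balaban1983to89.Beta.UnitSectorSplit` — what the UNIT SECTOR must deliver to the large-`L` road:
the exact bookkeeping behind row an2's (L6-unit) (AN2.md v0.4 §8.11(a)), kernel-checked, with the
witness that scale-uniformity at each fixed `L` (the shape of an2's (H2)) is NOT enough

CITATION HEADER (lean-in-tree rule 2026-08-18).  Source under audit: T. Bałaban, *Renormalization group
approach to lattice gauge field theories. I*, Commun. Math. Phys. **109**, 249–301 (1987),
doi:10.1007/bf01215223 [Balaban1987RG1] (cell paper B12).  The printed statement this module is ABOUT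
(verbatim, p.264): «β_{j+1}(g_j) = −(∂²/∂p_μ∂p_ν) Π̃_{j+1,μν}(g_j, 0) … μ ≠ ν (1.22)» and «This limit exists
by the localized representation (1.7)»; nothing printed is re-asserted here.  This is a HYPOTHESIS-SHAPE
module in the style of `Beta.LargeL` / `Beta.MarginalTelescoping`: every coefficient is an abstract real
sequence `ℕ → ℕ → ℝ` indexed by the blocking factor `L` and the scale `k`; NOTHING about the value, sign or
existence of Bałaban's coefficients is asserted, and no object of the papers is constructed.

WHAT IS CERTIFIED (zero `sorry`; axioms ⊆ {propext, Classical.choice, Quot.sound}).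
* `SplitForm β0 bulk u g` — the shape of the (S′-exact) reorganisation of the one-step coefficient after
  telescoping (AN2 §8.6/§8.10(e)/§8.11(a); `Beta.MarginalTelescoping`): `β0 L k = bulk L k + (u L (k+1) −
  u L k) + (g L (k+1) − g L k)`, `u`/`g` = the unit / ghost-unit pieces AFTER `k` steps.
* `UnitSectorUniform u g A` — (L6-unit): `|u L k| + |g L k| ≤ A` for every `L ≥ 2` and every `k`, ONE `A`.
* `logGrowthLower_of_split`, `logGrowth_of_split`: (L6-unit) turns a log-growth (lower / two-sided) bound
  for the bulk piece with absolute constant `A₁` into the same bound for the total with constant `A₁ + 2A` —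
  i.e. exactly the hypothesis `Beta.LargeL.LogGrowthLower β0 b (A₁ + 2A)` consumed by `LargeL.betaAFH`.
  `logGrowthLower_bulk_of_split`: conversely the total's bound and (L6-unit) bound the bulk (so, GIVEN
  (L6-unit), log-growth of the total and of the bulk are equivalent up to `2A`).
* `UnitSectorKUniform u g Aof` — the WEAKER shape actually delivered by an2's (H2) (AN2 §8.3′): a bound
  `Aof L` uniform in the scale `k` but depending on `L`.
* THE WITNESS `kUniform_not_sufficient`: explicit sequences (`bulkW b L k = b·log L`, `uW L k = L·(k mod 2)`,
  `gW = 0`, `β0W` their `SplitForm` combination) for which the bulk satisfies the two-sided log-growth with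
  remainder `0`, the unit piece is `k`-uniformly bounded at every `L` (by `L`), and yet `LogGrowthLower β0W b A`
  FAILS FOR EVERY `A` (at scale `k = 1` the increment is `−L`, and `b·log L − A ≤ b·log L − L` is false for
  `L > A`).  So the `L`-uniformity in (L6-unit) is genuinely load-bearing: (H2) alone cannot feed (AF-0-L).

NOT CERTIFIED / NOT CLAIMED.  That Bałaban's (1.22) coefficient admits a `SplitForm` with the an2 pieces is
row an2's (S′-exact) analysis (AN2.md §8.6–8.10, records, not kernel); (L6-unit) itself is an OPEN
conjecture (AN2.md §8.11, GAPS G-an2-10/G-an2-11); the bulk log-growth is rows an1/an5/lead ((L1)–(L5)).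
HONEST FRAMING: discharging `FlowStep.BetaPertH` would make Bałaban's 4-d UV-stability theorem
unconditional — NOT the continuum limit, NOT Clay.  This module proves bookkeeping only.  NOT summit progress.
-/

namespace Literature.MathematicalPhysics.QuantumFieldTheory.Balaban1983to89.Beta.UnitSectorSplit

open Literature.MathematicalPhysics.QuantumFieldTheory.Balaban1983to89.Beta.LargeL

/-! ## §1 The shapes -/

/-- The (S′-exact)+telescoping shape of the one-step coefficient: bulk piece plus the INCREMENTS of the unit and
ghost-unit pieces (AN2.md §8.11(a)).  Hypothesis shape; nothing asserted. [folklore] -/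
def SplitForm (β0 bulk u g : ℕ → ℕ → ℝ) : Prop :=
  ∀ L k, β0 L k = bulk L k + (u L (k + 1) - u L k) + (g L (k + 1) - g L k)

/-- (L6-unit): the unit and ghost-unit pieces are bounded uniformly in the scale `k` AND in `L ≥ 2` by ONE
constant `A` (AN2.md §8.11(a),(d)).  Hypothesis shape; nothing asserted. [folklore] -/
def UnitSectorUniform (u g : ℕ → ℕ → ℝ) (A : ℝ) : Prop :=
  ∀ L : ℕ, 2 ≤ L → ∀ k : ℕ, |u L k| + |g L k| ≤ A

/-- The weaker shape of an2's (H2): at each fixed `L` a bound uniform in `k`, with an `L`-dependent constant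
`Aof L` (AN2.md §8.3′).  Hypothesis shape; nothing asserted. [folklore] -/
def UnitSectorKUniform (u g : ℕ → ℕ → ℝ) (Aof : ℕ → ℝ) : Prop :=
  ∀ L : ℕ, 2 ≤ L → ∀ k : ℕ, |u L k| + |g L k| ≤ Aof L

/-- (L6-unit) is the special case of the (H2)-shape with a constant function. [folklore] -/
theorem UnitSectorUniform.kUniform {u g : ℕ → ℕ → ℝ} {A : ℝ} (h : UnitSectorUniform u g A) :
    UnitSectorKUniform u g (fun _ => A) := h

/-! ## §2 (L6-unit) feeds the large-`L` road -/

section Feed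

variable {β0 bulk u g : ℕ → ℕ → ℝ} {b A A₁ : ℝ}

/-- Under (L6-unit) the two increments together are at most `2A` in absolute value. [folklore] -/
theorem abs_increments_le (hU : UnitSectorUniform u g A) {L : ℕ} (hL : 2 ≤ L) (k : ℕ) :
    |(u L (k + 1) - u L k) + (g L (k + 1) - g L k)| ≤ 2 * A := by
  have h0 := hU L hL k
  have h1 := hU L hL (k + 1)
  have hu : |u L (k + 1) - u L k| ≤ |u L (k + 1)| + |u L k| := abs_sub _ _
  have hg : |g L (k + 1) - g L k| ≤ |g L (k + 1)| + |g L k| := abs_sub _ _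
  calc |(u L (k + 1) - u L k) + (g L (k + 1) - g L k)|
      ≤ |u L (k + 1) - u L k| + |g L (k + 1) - g L k| := abs_add_le _ _
    _ ≤ (|u L (k + 1)| + |u L k|) + (|g L (k + 1)| + |g L k|) := add_le_add hu hg
    _ = (|u L (k + 1)| + |g L (k + 1)|) + (|u L k| + |g L k|) := by ring
    _ ≤ A + A := add_le_add h1 h0
    _ = 2 * A := by ring

/-- **(L6-unit) + bulk log-growth (lower) ⇒ log-growth (lower) of the total**, constant `A₁ + 2A`: exactly the
hypothesis `LargeL.LogGrowthLower β0 b (A₁ + 2A)` of the large-`L` road. [folklore] -/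
theorem logGrowthLower_of_split (hS : SplitForm β0 bulk u g) (hB : LogGrowthLower bulk b A₁)
    (hU : UnitSectorUniform u g A) : LogGrowthLower β0 b (A₁ + 2 * A) := by
  intro L hL k
  have h1 := hB L hL k
  have h2 := (abs_le.mp (abs_increments_le hU hL k)).1
  rw [hS L k]
  linarith

/-- Two-sided version: (L6-unit) + `LogGrowth bulk b A₁` ⇒ `LogGrowth β0 b (A₁ + 2A)`. [folklore] -/
theorem logGrowth_of_split (hS : SplitForm β0 bulk u g) (hB : LogGrowth bulk b A₁)
    (hU : UnitSectorUniform u g A) : LogGrowth β0 b (A₁ + 2 * A) := by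
  intro L hL k
  have h1 := abs_le.mp (hB L hL k)
  have h2 := abs_le.mp (abs_increments_le hU hL k)
  rw [hS L k, abs_le]
  constructor <;> linarith [h1.1, h1.2, h2.1, h2.2]

/-- Conversely, GIVEN (L6-unit), a log-growth lower bound of the total bounds the bulk: the two are equivalent
up to `2A`. [folklore] -/
theorem logGrowthLower_bulk_of_split (hS : SplitForm β0 bulk u g) (hT : LogGrowthLower β0 b A₁)
    (hU : UnitSectorUniform u g A) : LogGrowthLower bulk b (A₁ + 2 * A) := by
  intro L hL k
  have h1 := hT L hL k
  have h2 := (abs_le.mp (abs_increments_le hU hL k)).2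
  rw [hS L k] at h1
  linarith

end Feed

/-! ## §3 The witness: scale-uniformity at each `L` (the (H2) shape) is not enough -/

section Witness

/-- Witness bulk piece: exactly `b·log L` at every scale. [folklore] -/
noncomputable def bulkW (b : ℝ) : ℕ → ℕ → ℝ := fun L _ => b * Real.log L

/-- Witness unit piece: `L·(k mod 2)` — bounded by `L` uniformly in `k`, unbounded in `L`. [folklore] -/
def uW : ℕ → ℕ → ℝ := fun L k => (L : ℝ) * (k % 2 : ℕ)

/-- Witness ghost-unit piece: zero. [folklore] -/
def gW : ℕ → ℕ → ℝ := fun _ _ => 0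

/-- Witness total, DEFINED by the split form. [folklore] -/
noncomputable def β0W (b : ℝ) : ℕ → ℕ → ℝ :=
  fun L k => bulkW b L k + (uW L (k + 1) - uW L k) + (gW L (k + 1) - gW L k)

/-- The witness has the split form (by definition). [folklore] -/
theorem splitForm_W (b : ℝ) : SplitForm (β0W b) (bulkW b) uW gW := fun _ _ => rfl

/-- The witness bulk has exact two-sided log-growth with remainder `0`. [folklore] -/
theorem logGrowth_bulkW (b : ℝ) : LogGrowth (bulkW b) b 0 := by
  intro L _ k
  simp [bulkW]

/-- The witness unit sector is `k`-uniformly bounded at every `L`, with constant `L`. [folklore] -/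
theorem kUniform_W : UnitSectorKUniform uW gW (fun L => (L : ℝ)) := by
  intro L _ k
  have hk : (k % 2 : ℕ) ≤ 1 := Nat.lt_succ_iff.mp (Nat.mod_lt k (by norm_num))
  have hk' : ((k % 2 : ℕ) : ℝ) ≤ 1 := by exact_mod_cast hk
  have hk0 : (0 : ℝ) ≤ ((k % 2 : ℕ) : ℝ) := by positivity
  have hL0 : (0 : ℝ) ≤ (L : ℝ) := by positivity
  have hu : |uW L k| ≤ (L : ℝ) := by
    rw [uW, abs_of_nonneg (mul_nonneg hL0 hk0)]
    calc (L : ℝ) * ((k % 2 : ℕ) : ℝ) ≤ (L : ℝ) * 1 := mul_le_mul_of_nonneg_left hk' hL0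
      _ = L := mul_one _
  simpa [gW] using hu

/-- At scale `k = 1` the witness total is `b·log L − L`. [folklore] -/
theorem β0W_one (b : ℝ) (L : ℕ) : β0W b L 1 = b * Real.log L - L := by
  simp [β0W, bulkW, uW, gW]; ring

/-- **The witness defeats (AF-0-L) for every remainder constant**: no `A` makes `LogGrowthLower (β0W b) b A`
true, although the bulk is perfect and the unit sector is scale-uniform at each `L`. [folklore] -/
theorem not_logGrowthLower_W (b A : ℝ) : ¬ LogGrowthLower (β0W b) b A := by
  intro h
  obtain ⟨n, hn⟩ := exists_nat_gt (max A 2)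
  have hn2 : 2 ≤ n := by
    have : (2 : ℝ) < n := (le_max_right A 2).trans_lt hn
    exact_mod_cast this.le
  have hA : A < n := (le_max_left A 2).trans_lt hn
  have h1 := h n hn2 1
  rw [β0W_one] at h1
  linarith

/-- Packaged: scale-uniformity at each fixed `L` (the (H2) shape) together with a perfect bulk does NOT imply the
large-`L` hypothesis — the `L`-uniformity of (L6-unit) is load-bearing. [folklore] -/
theorem kUniform_not_sufficient :
    ∃ (β0 bulk u g : ℕ → ℕ → ℝ) (Aof : ℕ → ℝ) (b : ℝ), 0 < b ∧ SplitForm β0 bulk u g ∧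
      LogGrowth bulk b 0 ∧ UnitSectorKUniform u g Aof ∧ ∀ A : ℝ, ¬ LogGrowthLower β0 b A :=
  ⟨β0W 1, bulkW 1, uW, gW, fun L => (L : ℝ), 1, one_pos, splitForm_W 1, logGrowth_bulkW 1, kUniform_W,
    not_logGrowthLower_W 1⟩

end Witness

/-! ## §4 Non-vacuity of the positive direction -/

/-- The hypotheses of `logGrowthLower_of_split` are jointly satisfiable (constant pieces). [folklore] -/
example : ∃ (β0 bulk u g : ℕ → ℕ → ℝ), SplitForm β0 bulk u g ∧ LogGrowthLower bulk 1 0 ∧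
    UnitSectorUniform u g 0 := by
  refine ⟨fun L _ => Real.log L, fun L _ => Real.log L, fun _ _ => 0, fun _ _ => 0, ?_, ?_, ?_⟩
  · intro L k; simp
  · intro L _ k; simp
  · intro L _ k; simp

end Literature.MathematicalPhysics.QuantumFieldTheory.Balaban1983to89.Beta.UnitSectorSplit
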